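import Mathlib
import Literature.MathematicalPhysics.QuantumLattice.BdGBondHamiltonianTorus
import Literature.MathematicalPhysics.QuantumLattice.DirichletSineBasis

/-!
# Bridge: unit-step kernels on block offsets are the Dirichlet block kernels

Topic `MathematicalPhysics/QuantumLattice` (family `hubbard`). Block decompositions of the Hubbard
torus write the INNER nearest-neighbour pairs of a block `a + [0,R)²` through unit steps
`e ∈ {0, ±e₁, ±e₂}` and the integer condition `v = u + e` on offsets `u, v ∈ [0,R)²`
(cf. `localPair`, whose bond sum runs over `insert 0 unitSteps`). The Dirichlet sine basis
(`DirichletSineBasis.lean`) diagonalises the kernels `blockKernel R w` written with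
`Function.update`. This file identifies the two bookkeepings and packages the spectral identity in
the unit-step form:

* `forall_eq_add_single_iff`, `forall_eq_sub_single_iff` — `v = u ± e_i` (integer coordinates) iff
  `v_i = u_i ± 1` and `v = u[i ↦ v_i]`;
* `sum_insert_unitSteps_ite_eq` — for step weights `c` with `c(-e_i) = c(e_i)`:
  `Σ_{e ∈ {0} ∪ unitSteps} [v = u + e] c(e) = [u = v] c(0) + blockKernel R (i ↦ c(e_i)) u v`;
  `sum_unitSteps_ite_eq` — the same without the `0` step;
* `dWaveStepKernel_eq_sum_blockMode` — the `d_{x²-y²}` bond kernel of the block in the spectral form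
  consumed by the block pair Gram bound:
  `Σ_{e ∈ {0} ∪ unitSteps} [v = u + e] g_d(e)/√2 = Σ_j κ_j φ_j(u) φ_j(v)` with
  `φ_j = blockMode R j`, `κ_j = blockEigen R (1,-1) j / √2`, and `|κ_j| ≤ 2√2` (`abs_dWaveBlockEigen_div_sqrt_two_le`);
* `adjacencyStepKernel_eq_sum_blockMode` — the block adjacency `Σ_{e ∈ unitSteps} [v = u + e]`
  `= Σ_j λ_j φ_j(u) φ_j(v)`, `λ_j = blockEigen R (1,1) j` (`= -torusBand (2R+2) (j+1)`).

Folklore bookkeeping; no definition and no named fact is introduced.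
-/

namespace Literature.MathematicalPhysics.QuantumLattice

open Finset Literature.Probability.LatticeModels

noncomputable section

variable (R : ℕ)

/-! ### Unit steps versus coordinate updates -/

/-- `v = u + e_i` in integer coordinates iff `v_i = u_i + 1` and `v` agrees with `u` elsewhere.
[folklore] -/
theorem forall_eq_add_single_iff (u v : Fin 2 → Fin R) (i : Fin 2) :
    (∀ i', ((v i' : ℕ) : ℤ) = ((u i' : ℕ) : ℤ) + (Pi.single i (1 : ℤ) : Site 2) i') ↔
      ((u i : ℕ) + 1 = v i ∧ v = Function.update u i (v i)) := by
  constructor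
  · intro h
    refine ⟨?_, ?_⟩
    · have h1 := h i
      rw [Pi.single_eq_same] at h1
      omega
    · funext i'
      by_cases hi' : i' = i
      · subst hi'; rw [Function.update_self]
      · rw [Function.update_of_ne hi']
        have h1 := h i'
        rw [Pi.single_eq_of_ne hi', add_zero] at h1
        exact Fin.ext (by exact_mod_cast h1)
  · rintro ⟨h1, h2⟩ i'
    by_cases hi' : i' = i
    · subst hi'; rw [Pi.single_eq_same]; omega
    · have h3 := congrFun h2 i'
      rw [Function.update_of_ne hi'] at h3
      rw [Pi.single_eq_of_ne hi', add_zero, h3]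

/-- `v = u - e_i` in integer coordinates iff `v_i + 1 = u_i` and `v` agrees with `u` elsewhere.
[folklore] -/
theorem forall_eq_sub_single_iff (u v : Fin 2 → Fin R) (i : Fin 2) :
    (∀ i', ((v i' : ℕ) : ℤ) = ((u i' : ℕ) : ℤ) + (-(Pi.single i (1 : ℤ) : Site 2)) i') ↔
      ((v i : ℕ) + 1 = u i ∧ v = Function.update u i (v i)) := by
  constructor
  · intro h
    refine ⟨?_, ?_⟩
    · have h1 := h i
      rw [Pi.neg_apply, Pi.single_eq_same] at h1
      omega
    · funext i'
      by_cases hi' : i' = i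
      · subst hi'; rw [Function.update_self]
      · rw [Function.update_of_ne hi']
        have h1 := h i'
        rw [Pi.neg_apply, Pi.single_eq_of_ne hi', neg_zero, add_zero] at h1
        exact Fin.ext (by exact_mod_cast h1)
  · rintro ⟨h1, h2⟩ i'
    by_cases hi' : i' = i
    · subst hi'; rw [Pi.neg_apply, Pi.single_eq_same]; omega
    · have h3 := congrFun h2 i'
      rw [Function.update_of_ne hi'] at h3
      rw [Pi.neg_apply, Pi.single_eq_of_ne hi', neg_zero, add_zero, h3]

/-- `v = u + 0` iff `u = v`. [folklore] -/
theorem forall_eq_add_zero_iff (u v : Fin 2 → Fin R) :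
    (∀ i', ((v i' : ℕ) : ℤ) = ((u i' : ℕ) : ℤ) + (0 : Site 2) i') ↔ u = v := by
  constructor
  · intro h; funext i'; have h1 := h i'; rw [Pi.zero_apply, add_zero] at h1
    exact Fin.ext (by exact_mod_cast h1.symm)
  · rintro rfl i'; rw [Pi.zero_apply, add_zero]

/-- The `Function.update` form of one direction of the block kernel, collapsed to the single
admissible value `v' = v_i`. [folklore] -/
theorem sum_ite_update_eq (w : ℝ) (u v : Fin 2 → Fin R) (i : Fin 2) :
    (∑ v' : Fin R, if ((u i : ℕ) + 1 = v' ∨ (v' : ℕ) + 1 = u i) ∧ v = Function.update u i v'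
      then w else 0) =
      (if (u i : ℕ) + 1 = v i ∧ v = Function.update u i (v i) then w else 0) +
        (if (v i : ℕ) + 1 = u i ∧ v = Function.update u i (v i) then w else 0) := by
  classical
  rw [Finset.sum_eq_single (v i)]
  · by_cases hup : v = Function.update u i (v i)
    · by_cases h1 : (u i : ℕ) + 1 = v i
      · have h2 : ¬ ((v i : ℕ) + 1 = u i) := by omega
        rw [if_pos ⟨Or.inl h1, hup⟩, if_pos ⟨h1, hup⟩, if_neg (fun h => h2 h.1), add_zero]
      · by_cases h2 : (v i : ℕ) + 1 = u i
        · rw [if_pos ⟨Or.inr h2, hup⟩, if_neg (fun h => h1 h.1), if_pos ⟨h2, hup⟩, zero_add]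
        · rw [if_neg (fun h => h.1.elim h1 h2), if_neg (fun h => h1 h.1), if_neg (fun h => h2 h.1),
            add_zero]
    · rw [if_neg (fun h => hup h.2), if_neg (fun h => hup h.2), if_neg (fun h => hup h.2), add_zero]
  · intro v' _ hv'
    rw [if_neg]
    rintro ⟨_, h⟩
    exact hv' (by rw [h, Function.update_self])
  · exact fun h => absurd (Finset.mem_univ _) h

/-! ### The bridge identities -/

/-- **Bridge, `unitSteps` form**: for even step weights,
`Σ_{e ∈ unitSteps} [v = u + e] c(e) = blockKernel R (i ↦ c(e_i)) u v`. [folklore] -/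
theorem sum_unitSteps_ite_eq (c : Site 2 → ℝ) (hc : ∀ i : Fin 2, c (-Pi.single i 1) = c (Pi.single i 1))
    (u v : Fin 2 → Fin R) :
    (∑ e ∈ unitSteps, if (∀ i', ((v i' : ℕ) : ℤ) = ((u i' : ℕ) : ℤ) + e i') then c e else 0) =
      blockKernel R (fun i => c (Pi.single i 1)) u v := by
  classical
  rw [sum_unitSteps, blockKernel, Fin.sum_univ_two, sum_ite_update_eq, sum_ite_update_eq]
  simp only [if_congr (forall_eq_add_single_iff R u v 0) rfl rfl,
    if_congr (forall_eq_sub_single_iff R u v 0) rfl rfl,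
    if_congr (forall_eq_add_single_iff R u v 1) rfl rfl,
    if_congr (forall_eq_sub_single_iff R u v 1) rfl rfl, hc]
  ring

/-- **Bridge, `insert 0 unitSteps` form**: for even step weights,
`Σ_{e ∈ {0} ∪ unitSteps} [v = u + e] c(e) = [u = v] c(0) + blockKernel R (i ↦ c(e_i)) u v`. [folklore] -/
theorem sum_insert_unitSteps_ite_eq (c : Site 2 → ℝ)
    (hc : ∀ i : Fin 2, c (-Pi.single i 1) = c (Pi.single i 1)) (u v : Fin 2 → Fin R) :
    (∑ e ∈ insert (0 : Site 2) unitSteps,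
        if (∀ i', ((v i' : ℕ) : ℤ) = ((u i' : ℕ) : ℤ) + e i') then c e else 0) =
      (if u = v then c 0 else 0) + blockKernel R (fun i => c (Pi.single i 1)) u v := by
  classical
  rw [Finset.sum_insert zero_not_mem_unitSteps, sum_unitSteps_ite_eq R c hc,
    if_congr (forall_eq_add_zero_iff R u v) rfl rfl]

/-! ### The `d`-wave bond kernel and the adjacency of the block in spectral form -/

/-- The `d`-wave form factor is even under `e ↦ -e` on the unit steps (coordinate directions).
[folklore] -/
theorem dWaveFormFactor_neg_single (i : Fin 2) :
    dWaveFormFactor (-Pi.single i 1) = dWaveFormFactor (Pi.single i 1) := by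
  rw [dWaveFormFactor_neg_unitStep, dWaveFormFactor_unitStep]

/-- **The `d`-wave block bond kernel in spectral form** (the `hK` input of the block pair Gram
bound): `Σ_{e ∈ {0} ∪ unitSteps} [v = u + e] g_d(e)/√2 = Σ_j κ_j φ_j(u) φ_j(v)` with
`φ_j = blockMode R j` and `κ_j = blockEigen R (i ↦ g_d(e_i)) j / √2`. [folklore] -/
theorem dWaveStepKernel_eq_sum_blockMode (u v : Fin 2 → Fin R) :
    (∑ e ∈ insert (0 : Site 2) unitSteps,
        if (∀ i, ((v i : ℕ) : ℤ) = ((u i : ℕ) : ℤ) + e i) then dWaveFormFactor e / Real.sqrt 2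
        else 0) =
      ∑ j : Fin 2 → Fin R, (blockEigen R (fun i => dWaveFormFactor (Pi.single i 1)) j / Real.sqrt 2) *
        (blockMode R j u * blockMode R j v) := by
  rw [sum_insert_unitSteps_ite_eq R (fun e => dWaveFormFactor e / Real.sqrt 2)
    (fun i => by simp only [dWaveFormFactor_neg_single]) u v]
  simp only [dWaveFormFactor_zero, zero_div, ite_self, zero_add]
  -- `blockKernel` is linear in the weights: pull out `1/√2`
  have hlin : blockKernel R (fun i => dWaveFormFactor (Pi.single i 1) / Real.sqrt 2) u v =
      blockKernel R (fun i => dWaveFormFactor (Pi.single i 1)) u v / Real.sqrt 2 := by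
    simp only [blockKernel, Finset.sum_div]
    refine Finset.sum_congr rfl fun i _ => Finset.sum_congr rfl fun v' _ => ?_
    split_ifs <;> simp
  rw [hlin, ← sum_blockEigen_mul_blockMode_mul_blockMode, Finset.sum_div]
  exact Finset.sum_congr rfl fun j _ => by ring

/-- `|κ_j| ≤ 2√2` for the `d`-wave block eigenvalues `κ_j = blockEigen R (1,-1) j / √2`. [folklore] -/
theorem abs_dWaveBlockEigen_div_sqrt_two_le (j : Fin 2 → Fin R) :
    |blockEigen R (fun i => dWaveFormFactor (Pi.single i 1)) j / Real.sqrt 2| ≤ 2 * Real.sqrt 2 := by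
  have hsqrt : (0 : ℝ) < Real.sqrt 2 := Real.sqrt_pos.2 (by norm_num)
  have hg : ∀ i : Fin 2, |dWaveFormFactor (Pi.single i 1)| ≤ 1 := fun i => by
    rw [dWaveFormFactor_unitStep]
    split_ifs <;> simp
  have hlam : |blockEigen R (fun i => dWaveFormFactor (Pi.single i 1)) j| ≤ 4 := by
    unfold blockEigen
    refine (Finset.abs_sum_le_sum_abs _ _).trans ?_
    calc ∑ i : Fin 2, |dWaveFormFactor (Pi.single i 1) *
          (2 * Real.cos (Real.pi * ((j i : ℕ) + 1) / ((R : ℝ) + 1)))|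
        ≤ ∑ _i : Fin 2, (2 : ℝ) := Finset.sum_le_sum fun i _ => by
          rw [abs_mul, abs_mul, abs_two]
          calc |dWaveFormFactor (Pi.single i 1)| * (2 * |Real.cos (Real.pi * ((j i : ℕ) + 1) /
                ((R : ℝ) + 1))|) ≤ 1 * (2 * 1) := by
                gcongr
                · exact hg i
                · exact Real.abs_cos_le_one _
            _ = 2 := by ring
      _ = 4 := by simp; norm_num
  rw [abs_div, abs_of_pos hsqrt, div_le_iff₀ hsqrt]
  calc |blockEigen R (fun i => dWaveFormFactor (Pi.single i 1)) j| ≤ 4 := hlam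
    _ = 2 * Real.sqrt 2 * Real.sqrt 2 := by
        rw [mul_assoc, Real.mul_self_sqrt (by norm_num : (0 : ℝ) ≤ 2)]; norm_num

/-- **The block adjacency in spectral form**: `Σ_{e ∈ unitSteps} [v = u + e] = Σ_j λ_j φ_j(u) φ_j(v)`,
`λ_j = blockEigen R (1,1) j`. [folklore] -/
theorem adjacencyStepKernel_eq_sum_blockMode (u v : Fin 2 → Fin R) :
    (∑ e ∈ unitSteps, if (∀ i, ((v i : ℕ) : ℤ) = ((u i : ℕ) : ℤ) + e i) then (1 : ℝ) else 0) =
      ∑ j : Fin 2 → Fin R, blockEigen R (fun _ => 1) j * (blockMode R j u * blockMode R j v) := by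
  rw [sum_unitSteps_ite_eq R (fun _ => (1 : ℝ)) (fun _ => rfl) u v,
    ← sum_blockEigen_mul_blockMode_mul_blockMode]
  exact Finset.sum_congr rfl fun j _ => by ring

end

end Literature.MathematicalPhysics.QuantumLattice
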